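import Literature.ComputerArithmetic.Shewchuk1997.Compress
import Literature.ComputerArithmetic.JeannerodLouvetMuller2013.KahanDeterminant
import Literature.ComputerArithmetic.GraillatMuller2025.PowerOfTwoTest
import Mathlib.Tactic.Linarith
import Mathlib.Tactic.Positivity
import Mathlib.Tactic.Ring
import Mathlib.Tactic.NormNum
import Mathlib.Tactic.IntervalCases

/-!
# COMPRESS under any tie rule: an adjacent emitted pair is a tie replay or mergeable (new work)

New work of the certified-arithmetic venture (ENGINES group: shared numerical engines serving
client cells; rigour lives in the verifiers; every published number belongs to a client cell's
ledger, not to the engines group).  Theorem 23 of [Shewchuk1997, §2.7] makes `h = COMPRESS(e)`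
nonoverlapping under every round-to-nearest map and nonadjacent under round-to-even; the
venture's `CompressAdjacentTiesAway` shows that other tie rules DO leave adjacent pairs, and
`CompressAdjacencyInvariant` shows what survives at `p ≥ 4` (no double adjacency, one-bit lower
members).  THIS FILE isolates the local arithmetic fact behind all of it, valid for every
precision `p ≥ 2` and every round-to-nearest map `fl` (any tie rule):

REPLAY-OR-MERGE.  Consider a step `(x, q) = FAST-TWO-SUM(g, Q)` of the upward sweep of
COMPRESS (Lines 10–16: `g` the next component, a float; `Q` the carry, `|Q| ≤ ulp g`) taken
right after a roundoff `r` was emitted below a grid `2^u` on which the carry is normal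
(`OnGrid u Q`, `2^(p−1)·2^u ≤ |Q|`, `2|r| ≤ 2^u` — the situation recorded by the invariant
`AdjInv.hd` of `CompressAdjacencyInvariant`).  If the new roundoff `q` is ADJACENT to `r`
(`¬ Below 2 r q`) then EITHER the step is the identity, `(x, q) = (g, Q)` — the carry is emitted
verbatim, so the emitted pair `(r, Q)` is literally (roundoff, result) of the earlier rounding
that produced `Q`, a TIE REPLAY: `|r| = ulp(Q)/2` and `Q` is an ODD multiple of `ulp Q = 2^u`
(so this branch never occurs under round-to-even, which resolves the midpoint `Q + r` to the
even neighbour: the local reason for Theorem 23's nonadjacent clause) — OR `r + q` is itself a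
`p`-bit float (the pair is MERGEABLE).  `fastTwoSum_replay_or_mergeable`.

MECHANISM (`abs_lt_of_residue`).  Adjacency forces `|r| = 2^(u−1)` and `q ∉ 2^(u+1)ℤ`, hence
`Q ∉ 2^(u+1)ℤ`, `|Q| < 2^p·2^u` and `ulp g = 2^k` with `k ≥ u + p`.  Both `g` and `x` lie on
the half-ulp grid `2^(k−1)ℤ` (`|g + Q| ≥ (2^(p−1) − 1)·2^k`), so `Q − q = x − g = j·2^(k−1)`,
`j ≠ 0` unless the step is the identity; `|q| ≤ |Q|` (the float `g` is a rounding candidate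
[JeannerodRump2018, App. B]) and `|q| ≤ ulp(g + Q)/2 ≤ 2^(k−1)`.  In units of `2^u`, with
`P = 2^(p−1)`, `h = 2^(k−1−u) ∈ {P, 2P} ∪ [4P, ∞)`: `m − n = j·h`, `|n| ≤ h`, `|n| ≤ |m|`,
`P < |m| < 2P` force `|j| ≤ 2` and `|n| < P`, i.e. `|q| < 2^(p−1)·2^u`; then
`r + q = (2n ± 1)·2^(u−1)` has at most `p` bits.  HONEST FRAMING: nothing here is claimed by
the paper; the statement was found experimentally (integer model, `p = 2..6`, six tie rules and
hash-decided ones: 350 000 adjacent consecutive pairs of iterated COMPRESS outputs are all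
verbatim tie replays or have a representable sum, and 3.6 million sampled step states obey the
dichotomy, no exception) and is proved here from the step's hypotheses alone; its use for
COMPRESS outputs (which needs the sweep invariant of `CompressAdjacencyInvariant`) is left to a
sequel.
-/

namespace Summit.Ventures.CertifiedArithmetic.Expansions

open Literature.ComputerArithmetic.JeannerodRump2018
open Literature.ComputerArithmetic.BoldoJeannerodMelquiondMuller2023 hiding twoSum twoSum_fst
open Literature.ComputerArithmetic.Shewchuk1997
open Literature.ComputerArithmetic

variable {p : ℕ} {emin : ℤ} {fl : ℚ → ℚ}

/-! ### The integer core -/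

/-- INTEGER CORE of replay-or-merge.  `P = 2^(p−1)`; `h` is the half-ulp of the summand `g` in
units of `2^u` (a power of two `≥ P`: `h = P`, `h = 2P` or `h ≥ 4P`); `m, n` are the carry `Q`
and the new roundoff `q` in units of `2^u`; `j·h = m − n` is `(x − g)/2^u`.  If the step moved
(`j ≠ 0`), `|n| ≤ h` (half-ulp roundoff), `|n| ≤ |m|` (`g` is a rounding candidate) and
`P ≤ |m| < 2P`, `|m| ≠ P` (normal, odd carry) then `|n| < P`. [cite: Shewchuk1997, Thm 23
p. 333 (setting); BoldoEtAl2023, §2.1] -/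
theorem abs_lt_of_residue {P h m n j : ℤ} (hP : 1 ≤ P)
    (hh : h = P ∨ h = 2 * P ∨ 4 * P ≤ h) (hj : j ≠ 0) (hmn : m - n = j * h) (hn1 : |n| ≤ h)
    (hn2 : |n| ≤ |m|) (hm1 : P ≤ |m|) (hm2 : |m| < 2 * P) (hmP : |m| ≠ P) : |n| < P := by
  have hPh : P ≤ h := by omega
  have hh0 : 0 < h := by omega
  have hjh : |j| * h < 4 * h := by
    have e : |j| * h = |m - n| := by rw [hmn, abs_mul, abs_of_pos hh0]
    have := abs_sub m n
    linarith
  have hj4 : |j| < 4 := lt_of_mul_lt_mul_right hjh hh0.le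
  rw [abs_lt] at hj4
  obtain ⟨hj1, hj2⟩ := hj4
  rcases abs_cases n with ⟨hn, -⟩ | ⟨hn, -⟩ <;>
    rcases abs_cases m with ⟨hm, -⟩ | ⟨hm, -⟩ <;>
    rw [hn] at hn1 hn2 ⊢ <;> rw [hm] at hn2 hm1 hm2 hmP <;> interval_cases j <;> omega

/-! ### A float-format helper -/

/-- A float that is NOT on the grid `2^(u+1)` is shorter than `2^p·2^u` (its exponent is at
most `u`). [cite: BoldoEtAl2023, §2.1 Def. 2.1] -/
theorem abs_lt_of_isFloat_of_not_onGrid {Q : ℚ} {u : ℤ} (hQ : IsFloat p emin Q)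
    (hodd : ¬ OnGrid (u + 1) Q) : |Q| < 2 ^ p * (2 : ℚ) ^ u := by
  obtain ⟨M, e, hM, -, rfl⟩ := hQ
  have h2e : (0 : ℚ) < 2 ^ e := zpow_pos (by norm_num) _
  rcases le_or_gt e u with hle | hlt
  · have hM' : |(M : ℚ)| < 2 ^ p := by exact_mod_cast hM
    rw [abs_mul, abs_of_pos h2e]
    calc |(M : ℚ)| * 2 ^ e < 2 ^ p * 2 ^ e := mul_lt_mul_of_pos_right hM' h2e
      _ ≤ 2 ^ p * 2 ^ u :=
        mul_le_mul_of_nonneg_left (zpow_le_zpow_right₀ (by norm_num) hle) (by positivity)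
  · exfalso
    refine hodd ⟨M * 2 ^ (e - (u + 1)).toNat, ?_⟩
    push_cast
    rw [← zpow_natCast, Int.toNat_of_nonneg (by omega), mul_assoc,
      ← zpow_add₀ (by norm_num : (2 : ℚ) ≠ 0)]
    congr 2; omega

/-! ### Replay or merge -/

/-- **REPLAY-OR-MERGE** (`p ≥ 2`, any round-to-nearest `fl`).  In a step
`(x, q) = FAST-TWO-SUM(g, Q)` of the upward sweep (`g, Q` floats, `|Q| ≤ ulp g`) whose carry
`Q` is normal on a grid `2^u` (`OnGrid u Q`, `2^(p−1)·2^u ≤ |Q|`, `emin ≤ u`) below which the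
previous roundoff `r` (a float) sits (`2|r| ≤ 2^u`): if `q` is adjacent to `r` (`¬ Below 2 r q`)
then either the step is the identity `(x, q) = (g, Q)`, `|r| = ulp(Q)/2` and `Q` is an odd
multiple of `ulp Q = 2^u` (a TIE REPLAY: `r, Q` are emitted exactly as the earlier rounding
`Q = fl(Q + r)` of the midpoint `Q + r` produced them — impossible under round-to-even, which
resolves a midpoint to the even neighbour) or `r + q` is a `p`-bit float (a MERGEABLE pair).
[cite: Shewchuk1997, Thm 23 p. 333; JeannerodRump2018, App. B; BoldoEtAl2023, §2.1] -/
theorem fastTwoSum_replay_or_mergeable (hp : 2 ≤ p) (hfl : IsRoundNearest p emin fl)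
    {r Q g : ℚ} {u : ℤ} (hu : emin ≤ u) (huQ : OnGrid u Q) (hr : 2 * |r| ≤ (2 : ℚ) ^ u)
    (hQbig : (2 : ℚ) ^ u * 2 ^ (p - 1) ≤ |Q|) (hQ : IsFloat p emin Q) (hrF : IsFloat p emin r)
    (hg : IsFloat p emin g) (hQg : |Q| ≤ ulp p emin g)
    (hadj : ¬ Below 2 r (fastTwoSum fl g Q).2) :
    (fastTwoSum fl g Q = (g, Q) ∧ 2 * |r| = ulp p emin Q ∧ ¬ OnGrid (u + 1) Q) ∨
      IsFloat p emin (r + (fastTwoSum fl g Q).2) := by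
  have hp1 : 1 ≤ p := by omega
  have h2ne : (2 : ℚ) ≠ 0 := two_ne_zero
  have hA : (0 : ℚ) < 2 ^ u := zpow_pos (by norm_num) _
  have hP1 : (1 : ℚ) ≤ 2 ^ (p - 1) := one_le_pow₀ (by norm_num)
  have hP2 : (2 : ℚ) ≤ 2 ^ (p - 1) :=
    calc (2 : ℚ) = 2 ^ 1 := by norm_num
      _ ≤ 2 ^ (p - 1) := pow_le_pow_right₀ (by norm_num) (by omega)
  have hQ1 : (2 : ℚ) ^ u ≤ |Q| := le_trans (le_mul_of_one_le_right hA.le hP1) hQbig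
  have hQ0 : Q ≠ 0 := abs_pos.mp (hA.trans_le hQ1)
  -- `ulp g = 2^k`, `g = M·2^k` normal
  obtain ⟨k, hk, hU⟩ := exists_ulp_eq_two_zpow (p := p) (emin := emin) g
  have hK : (0 : ℚ) < 2 ^ k := zpow_pos (by norm_num) _
  rw [hU] at hQg
  have hUg : (2 : ℚ) ^ k * 2 ^ (p - 1) ≤ |g| := by
    rcases lt_or_ge |g| ((2 : ℚ) ^ (emin + p - 1)) with hs | hn
    · exfalso
      have he := ulp_eq_of_abs_lt (p := p) (emin := emin) hs
      rw [hU] at he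
      have h1 : (2 : ℚ) ^ k ≤ 2 ^ u := by rw [he]; exact zpow_le_zpow_right₀ (by norm_num) hu
      have h2 : (2 : ℚ) ^ u * 2 ^ (p - 1) ≤ 2 ^ u * 1 := by
        linarith [hQbig.trans (hQg.trans h1)]
      have h3 := le_of_mul_le_mul_left h2 hA
      linarith
    · have := ulp_le_of_normal hp1 hn
      rwa [hU, le_div_iff₀ (by positivity)] at this
  have hKg : (2 : ℚ) ^ k ≤ |g| := le_trans (le_mul_of_one_le_right hK.le hP1) hUg
  have hQleg : |Q| ≤ |g| := hQg.trans hKg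
  -- the step
  obtain ⟨h1, -, h2, h4⟩ := fastTwoSum_exact hp1 hfl hg hQ hQleg
  have hF12 := isFloat_fastTwoSum hfl g Q
  have hgu : OnGrid u g := onGrid_of_two_zpow_le_ulp hg (by rw [hU]; exact hQ1.trans hQg)
  obtain ⟨-, hsq⟩ := onGrid_fastTwoSum hp1 hfl hu hgu huQ
  have hq_le_Q : |(fastTwoSum fl g Q).2| ≤ |Q| := by
    rw [h2, abs_sub_comm]; exact abs_err_le_abs_operand hfl hg Q
  have hq_half : |(fastTwoSum fl g Q).2| ≤ ulp p emin (g + Q) / 2 := by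
    rw [h2]; exact abs_sub_fl_le_half_ulp hp1 hfl _
  have hulp_x : ulp p emin (g + Q) ≤ ulp p emin (fastTwoSum fl g Q).1 := by
    rw [h1]; exact ulp_le_ulp_fl hp1 hfl _
  generalize hxn : (fastTwoSum fl g Q).1 = x at *
  generalize hqn : (fastTwoSum fl g Q).2 = q at *
  -- adjacency to `r`: `2|r| = 2^u`, `q ∉ 2^(u+1)ℤ`
  have hr_eq : 2 * |r| = (2 : ℚ) ^ u := by
    by_contra hne
    exact hadj ⟨u, hsq, lt_of_le_of_ne hr hne⟩
  have hnot : ¬ OnGrid (u + 1) q := fun h' =>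
    hadj ⟨u + 1, h', by rw [hr_eq, zpow_add_one₀ h2ne]; linarith⟩
  -- `|Q| < 2^k` strictly (else `g + Q` is a float and `q = 0`, which is never adjacent to `r`)
  have hq0 : q ≠ 0 := by
    rintro rfl
    exact hadj ⟨u + 1, OnGrid.zero _, by rw [hr_eq, zpow_add_one₀ h2ne]; linarith⟩
  obtain ⟨M, hM⟩ := exists_eq_int_mul_ulp_of_isFloat (p := p) (emin := emin) hg
  rw [hU] at hM
  have h2p : (2 : ℤ) ^ p = 2 ^ (p - 1) * 2 := by rw [← pow_succ]; congr 1; omega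
  have hMp : |M| ≤ 2 ^ p - 1 := by
    have h := abs_lt_two_pow_mul_ulp (p := p) (emin := emin) g
    rw [hU, hM, abs_mul, abs_of_pos hK] at h
    have : |(M : ℚ)| < 2 ^ p := lt_of_mul_lt_mul_right h hK.le
    have : |M| < (2 : ℤ) ^ p := by exact_mod_cast this
    linarith
  have hQU : |Q| < (2 : ℚ) ^ k := by
    refine lt_of_le_of_ne hQg fun hQe => hq0 ?_
    have hsF : IsFloat p emin (g + Q) := by
      rcases (abs_eq hK.le).mp hQe with hQ' | hQ'
      · have := isFloat_of_abs_le (p := p) (emin := emin) hp1 (N := M + 1) (k := k)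
          (by rw [abs_le] at hMp ⊢; constructor <;> linarith [hMp.1, hMp.2]) hk
        rw [hM, hQ']; convert this using 1; push_cast; ring
      · have := isFloat_of_abs_le (p := p) (emin := emin) hp1 (N := M - 1) (k := k)
          (by rw [abs_le] at hMp ⊢; constructor <;> linarith [hMp.1, hMp.2]) hk
        rw [hM, hQ']; convert this using 1; push_cast; ring
    rw [h2, fl_eq_self hfl hsF, sub_self]
  -- hence `k ≥ u + p`
  have hkup : u + p ≤ k := by
    have : (2 : ℚ) ^ (u + (p - 1 : ℕ)) < 2 ^ k := by
      rw [zpow_add₀ h2ne, zpow_natCast]; exact hQbig.trans_lt hQU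
    have := (zpow_lt_zpow_iff_right₀ (by norm_num : (1 : ℚ) < 2)).mp this
    omega
  -- `g` and `x` lie on the half-ulp grid `2^(k-1)`
  have hgG : OnGrid (k - 1) g :=
    onGrid_of_two_zpow_le_ulp hg (by rw [hU]; exact zpow_le_zpow_right₀ (by norm_num) (by omega))
  have hs_big : (2 : ℚ) ^ (k + p - 2) ≤ |g + Q| := by
    have i2 := abs_sub_abs_le_abs_sub g (-Q)
    rw [abs_neg, sub_neg_eq_add] at i2
    have e : (2 : ℚ) ^ (k + p - 2) = 2 ^ k * 2 ^ (p - 1) / 2 := by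
      rw [show k + p - 2 = k + ((p - 1 : ℕ) : ℤ) - 1 by omega, zpow_sub_one₀ h2ne,
        zpow_add₀ h2ne, zpow_natCast]; ring
    rw [e]
    nlinarith [mul_nonneg hK.le (sub_nonneg.mpr hP2)]
  have hxG : OnGrid (k - 1) x := by
    refine onGrid_of_two_zpow_le_ulp hF12.1 (le_trans ?_ hulp_x)
    have := two_zpow_le_ulp_of_le_abs (p := p) (emin := emin) (k + p - 2) hs_big
    calc (2 : ℚ) ^ (k - 1) = 2 ^ (k + p - 2 - p + 1) := by congr 1; omega
      _ ≤ ulp p emin (g + Q) := this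
  -- `Q ∉ 2^(u+1)ℤ`, so `|Q| < 2^p·2^u` and `|Q| ≠ 2^(p-1)·2^u`
  have hd : OnGrid (k - 1) (x - g) := hxG.sub hgG
  have hQq : Q = q + (x - g) := by linarith [h4]
  have hQodd : ¬ OnGrid (u + 1) Q := fun hQ' =>
    hnot (by rw [show q = Q - (x - g) by linarith [h4]]; exact hQ'.sub (hd.mono (by omega)))
  have hQlt : |Q| < 2 ^ p * (2 : ℚ) ^ u := abs_lt_of_isFloat_of_not_onGrid hQ hQodd
  have hulpQ : ulp p emin Q = (2 : ℚ) ^ u :=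
    le_antisymm (JeannerodLouvetMuller2013.ulp_le_two_zpow hu hQlt)
      (JeannerodLouvetMuller2013.two_zpow_le_ulp hp1 (by rw [mul_comm]; exact hQbig))
  -- the identity step: a tie replay
  by_cases hxg : x = g
  · refine Or.inl ⟨Prod.ext (hxn.trans hxg) (hqn.trans ?_), by rw [hulpQ, hr_eq], hQodd⟩
    rw [hxg] at h4; linarith
  right
  -- `|q| ≤ 2^(k-1)`
  have hq_K : |q| ≤ (2 : ℚ) ^ (k - 1) := by
    have hsU : ulp p emin (g + Q) ≤ (2 : ℚ) ^ k := by
      refine JeannerodLouvetMuller2013.ulp_le_two_zpow hk ?_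
      have i1 := abs_add_le g Q
      rw [hM] at i1 ⊢
      rw [abs_mul, abs_of_pos hK] at i1
      have hMq : |(M : ℚ)| ≤ 2 ^ p - 1 := by exact_mod_cast hMp
      nlinarith [mul_le_mul_of_nonneg_right hMq hK.le]
    rw [zpow_sub_one₀ h2ne]
    linarith
  -- pass to integers in units of `2^u`
  obtain ⟨m, hm⟩ := huQ
  obtain ⟨n, hn⟩ := hsq
  obtain ⟨j, hj⟩ := hd
  have hku : 1 ≤ k - 1 - u := by omega
  obtain ⟨a, ha⟩ : ∃ a : ℕ, (a : ℤ) = k - 1 - u :=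
    ⟨(k - 1 - u).toNat, Int.toNat_of_nonneg (by omega)⟩
  have hKa : (2 : ℚ) ^ (k - 1) = (2 : ℚ) ^ a * 2 ^ u := by
    rw [← zpow_natCast, ha, ← zpow_add₀ h2ne]; congr 1; omega
  -- the hypotheses of the integer core
  have hPa : p - 1 ≤ a := by omega
  have hh : (2 : ℤ) ^ a = 2 ^ (p - 1) ∨ (2 : ℤ) ^ a = 2 * 2 ^ (p - 1) ∨
      4 * 2 ^ (p - 1) ≤ (2 : ℤ) ^ a := by
    rcases Nat.lt_or_ge a (p + 1) with h | h
    · rcases Nat.lt_or_ge a p with h' | h'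
      · exact Or.inl (by rw [show a = p - 1 by omega])
      · exact Or.inr (Or.inl (by rw [show a = p - 1 + 1 by omega, pow_succ]; ring))
    · refine Or.inr (Or.inr ?_)
      calc (4 : ℤ) * 2 ^ (p - 1) = 2 ^ (p - 1 + 2) := by rw [pow_add]; ring
        _ ≤ 2 ^ a := pow_le_pow_right₀ (by norm_num) (by omega)
  have hj0 : j ≠ 0 := by
    rintro rfl
    simp only [Int.cast_zero, zero_mul] at hj
    exact hxg (by linarith)
  have hmn : m - n = j * 2 ^ a := by
    have e : ((m - n : ℤ) : ℚ) * 2 ^ u = ((j * 2 ^ a : ℤ) : ℚ) * 2 ^ u := by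
      have e1 : (m : ℚ) * 2 ^ u - n * 2 ^ u = j * 2 ^ (k - 1) := by
        rw [← hm, ← hn, ← hj]; linarith [h4]
      push_cast
      rw [sub_mul, e1, hKa, mul_assoc]
    exact_mod_cast mul_right_cancel₀ hA.ne' e
  have hn1 : |n| ≤ (2 : ℤ) ^ a := by
    have : |(n : ℚ)| * 2 ^ u ≤ 2 ^ a * 2 ^ u := by
      have h := hq_K
      rwa [hn, abs_mul, abs_of_pos hA, hKa] at h
    exact_mod_cast le_of_mul_le_mul_right this hA
  have hn2 : |n| ≤ |m| := by
    have : |(n : ℚ)| * 2 ^ u ≤ |(m : ℚ)| * 2 ^ u := by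
      have h := hq_le_Q
      rwa [hn, hm, abs_mul, abs_mul, abs_of_pos hA] at h
    exact_mod_cast le_of_mul_le_mul_right this hA
  have hm1 : (2 : ℤ) ^ (p - 1) ≤ |m| := by
    have : (2 : ℚ) ^ (p - 1) * 2 ^ u ≤ |(m : ℚ)| * 2 ^ u := by
      have h := hQbig
      rwa [hm, abs_mul, abs_of_pos hA, mul_comm ((2 : ℚ) ^ u)] at h
    exact_mod_cast le_of_mul_le_mul_right this hA
  have hm2 : |m| < 2 * (2 : ℤ) ^ (p - 1) := by
    have : |(m : ℚ)| * 2 ^ u < 2 ^ p * 2 ^ u := by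
      have h := hQlt
      rwa [hm, abs_mul, abs_of_pos hA] at h
    have h' : |(m : ℚ)| < 2 ^ p := lt_of_mul_lt_mul_right this hA.le
    have h'' : |m| < (2 : ℤ) ^ p := by exact_mod_cast h'
    linarith
  have hmP : |m| ≠ (2 : ℤ) ^ (p - 1) := by
    intro hmeq
    apply hQodd
    -- `Q = ± 2^(p-1)·2^u = ± 2^(p-2)·2^(u+1)`
    have hp2 : p - 1 = p - 2 + 1 := by omega
    rcases (abs_eq (by positivity : (0 : ℤ) ≤ 2 ^ (p - 1))).mp hmeq with h' | h'
    · refine ⟨2 ^ (p - 2), ?_⟩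
      rw [hm, h', zpow_add_one₀ h2ne]; push_cast; rw [hp2, pow_succ]; ring
    · refine ⟨-2 ^ (p - 2), ?_⟩
      rw [hm, h', zpow_add_one₀ h2ne]; push_cast; rw [hp2, pow_succ]; ring
  -- the core: `|n| < 2^(p-1)`, i.e. `|q| < 2^(p-1)·2^u`
  have hcore := abs_lt_of_residue (P := 2 ^ (p - 1)) (h := 2 ^ a)
    (by exact_mod_cast Nat.one_le_two_pow) hh hj0 hmn hn1 hn2 hm1 hm2 hmP
  -- `r + q = (2n ± 1)·2^(u-1)` is a float
  have hr_abs : |r| = (2 : ℚ) ^ (u - 1) := by rw [zpow_sub_one₀ h2ne]; linarith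
  have hue : emin ≤ u - 1 := GraillatMuller2025.emin_le_of_abs_eq_two_zpow hrF hr_abs
  have hnq : q = (2 * n : ℤ) * (2 : ℚ) ^ (u - 1) := by
    rw [hn, zpow_sub_one₀ h2ne]; push_cast; ring
  rw [abs_lt] at hcore
  rcases (abs_eq (zpow_nonneg (by norm_num) (u - 1))).mp hr_abs with h' | h'
  · have := isFloat_of_abs_le (p := p) (emin := emin) hp1 (N := 2 * n + 1) (k := u - 1)
      (by rw [abs_le, h2p]; constructor <;> linarith [hcore.1, hcore.2]) hue
    convert this using 1; rw [h', hnq]; push_cast; ring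
  · have := isFloat_of_abs_le (p := p) (emin := emin) hp1 (N := 2 * n - 1) (k := u - 1)
      (by rw [abs_le, h2p]; constructor <;> linarith [hcore.1, hcore.2]) hue
    convert this using 1; rw [h', hnq]; push_cast; ring

/-- The non-mergeable case of replay-or-merge: an adjacent emitted pair whose sum is NOT a
float came from an identity step — the carry `Q` is emitted verbatim above `r`, and `r` is
exactly half an ulp of `Q`. [cite: Shewchuk1997, Thm 23 p. 333] -/
theorem fastTwoSum_eq_of_adjacent_of_not_isFloat (hp : 2 ≤ p) (hfl : IsRoundNearest p emin fl)
    {r Q g : ℚ} {u : ℤ} (hu : emin ≤ u) (huQ : OnGrid u Q) (hr : 2 * |r| ≤ (2 : ℚ) ^ u)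
    (hQbig : (2 : ℚ) ^ u * 2 ^ (p - 1) ≤ |Q|) (hQ : IsFloat p emin Q) (hrF : IsFloat p emin r)
    (hg : IsFloat p emin g) (hQg : |Q| ≤ ulp p emin g)
    (hadj : ¬ Below 2 r (fastTwoSum fl g Q).2)
    (hnm : ¬ IsFloat p emin (r + (fastTwoSum fl g Q).2)) :
    fastTwoSum fl g Q = (g, Q) ∧ 2 * |r| = ulp p emin Q ∧ ¬ OnGrid (u + 1) Q :=
  (fastTwoSum_replay_or_mergeable hp hfl hu huQ hr hQbig hQ hrF hg hQg hadj).resolve_right hnm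

end Summit.Ventures.CertifiedArithmetic.Expansions
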